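import Summits.Ventures.AbcSig.Rows.Bridge
import Summits.Ventures.AbcSig.Rows.C2aL293A45
import Summits.Ventures.AbcSig.Rows.C2aL293A45AB

/-!
# Venture AbcSig — CELL `C2aL293A45`: the census statement `Rows.C2aCellRed 293 (fun a => a = 4 ∨ a = 5) {11}` from the two row theorems

HONEST FRAMING. COMPUTATION cell `pub-abcsig`; CONDITIONAL theorem; no claim on ABC or any summit. Hypotheses exactly as
in `Rows/C2aL293A45.lean` and `Rows/C2aL293A45AB.lean`: `BS04Package` (CITED), `DataComplete …` (COMPUTED level files), and the
rows' per-orbit exclusions for BOTH family predicates (`famB`, `famAB`) as universally quantified hypotheses (CITED: the census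
row's certificates). Conclusion = p1's census predicate (`Rows/Statements.lean`), all four coprime coefficient
distributions `A·B = 2^a·293^m`, reduced exponents `a < n`, `m < n` (RULING H1). GENERATED by p-lean g2 gen/make_rows.py
(after plean/make_cell_bridges.py).
-/

namespace Summit.Ventures.AbcSig

/-- Cell `C2aL293A45`: `Rows.C2aCellRed 293 (fun a => a = 4 ∨ a = 5) {11}` under the rows' hypotheses. -/
theorem cell_C2aL293A45 (M : NewformModel) (hP : M.BS04Package)
    (hD586 : M.DataComplete 586 level586Orbits)
    (hD2344 : M.DataComplete 2344 level2344Orbits) :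
    Rows.C2aCellRed 293 (fun a => a = 4 ∨ a = 5) {11} :=
  C2aCellRed_of_rows 293 (by norm_num) (by norm_num) _ _
    (fun n hn h11 hnℓ hR a m ha han hm hmn x y z h1 h2 =>
      row_C2aL293A45 M hP hD586 hD2344 n hn h11 hnℓ (by simpa using hR) a m ha hm han hmn x y z h1 h2)
    (fun n hn h11 hnℓ hR a m ha han hm hmn x y z h1 h2 =>
      row_C2aL293A45AB M hP hD586 hD2344 n hn h11 hnℓ (by simpa using hR) a m ha hm han hmn x y z h1 h2)

end Summit.Ventures.AbcSig
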